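import Summits.AtomisticToContinuum.HydrodynamicLimit.Theorems.KickFairRelEquilibriumMeso.Negative.WindowAlgebra

/-!
# Line `kinetic-window-triangle` of crux stmt-AtomisticToContinuum-15177
(`InformationPercolationEngine.KickFairRelEquilibriumMeso`) — NO CONCLUDING SKELETON; typed SUPPORT residue

crux-plan seat `planner-cruxplan-stmt-AtomisticToContinuum-15177-kinetic-window-trian-0`, 2026-08-16.

**This file is NOT a skeleton**: it registers no `stub_*` and contains no `KickFairRelEquilibriumMeso_of`
(verdict `no-skeleton`, reasons in `Lines/kinetic-window-triangle.md`; this file is published as `Lines/kinetic_window_triangle_support.lean`). It is sorry-free and types the one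
constructive residue that all three triagers (TRIAGE-r1-1/2/3) and this planner agree on:

* `EquilibriumMesoBody rs` — the crux's body `MesoBody rs` (landed window algebra,
  `…Theorems.KickFairRelEquilibriumMesoNegative`, p109023) restricted to CONSTANT profiles `(a, u, θ)`
  (`localGibbsLaw σ a u θ` with constants = the invariant canonical law at activity `a`, drift `u`,
  temperature `θ`): "under the invariant law, the `κ`-centred kick sum is `L¹`-small, uniformly over
  admissible past-measurable weights" — the card's C⁺ `EquilibriumKickFairMeso`, i.e. the EQUILIBRIUM HALF
  of the crux;
* `EquilibriumKickFairMeso` — that body along EVERY admissible cell sequence (what the card's lever claims to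
  prove: triangle over kinetic windows + regional factorisation of the invariant law given occupancies +
  one-window light cone + Bessel control of the non-nested leak);
* `EquilibriumKickFairMesoSome` — the same along SOME admissible sequence;
* the two NECESSITY certificates `equilibriumMesoBody_of_mesoBody` (specialise the profiles to constants) and
  `equilibriumKickFairMesoSome_of_kickFairRelEquilibriumMeso` (the crux implies the `Some` form), and
  `equilibriumKickFairMesoSome_of_equilibriumKickFairMeso` (the `∀ rs` form implies the `∃ rs` form, via the
  admissible witness `(N+1)^{-1/4}`).

So `EquilibriumKickFairMeso(Some)` is a NECESSARY SPECIAL CASE of the crux, strictly weaker than it (the crux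
quantifies over all continuous positive profiles), hence a legitimate `--supports stmt-…-15177` target and NOT
a costume; what it is not is a line: no honest complement stub `EquilibriumKickFairMeso → … → crux` exists
short of the crux's own non-equilibrium content (see the `.md`, §2 C1–C4). Recommended filing (tenure planner):
`ledger workitem add --kind statement --route route-AtomisticToContinuum-InformationPercolationEngine --rank 9
 --name EquilibriumKickFairMeso --signature "$(cat signature-EquilibriumKickFairMeso.txt)" --informal '[support] …'`
— the signature text is §3's `EquilibriumKickFairMesoSig`, certified `Iff.rfl`-equal to `EquilibriumKickFairMeso`.
-/

open MeasureTheory Metric Real Set Filter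
open scoped ENNReal BigOperators Classical Topology

namespace Summit.AtomisticToContinuum.HydrodynamicLimit.Cruxes.KickFairRelEquilibriumMeso.KineticWindowTriangle

noncomputable section

open Literature.MathematicalPhysics.KineticTheory (T3 V3 hsDiameter localGibbsLaw)
open Literature.Analysis.FluidPDE (HardSphereFlow Config collisionTimesOf flightStart Geometry)
open Summit.AtomisticToContinuum.HydrodynamicLimit.Theses.InformationPercolationEngine
  (KickFairRelEquilibriumMeso)
open Summit.AtomisticToContinuum.HydrodynamicLimit.Theorems.KickFairRelEquilibriumMesoNegative
  (PastRel Flow KickBoundRel MesoBody LowerEdge kickFairRelEquilibriumMeso_iff)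

/-! ## §1 The equilibrium half of the crux, typed -/

/-- **The crux's body at CONSTANT profiles** `(a, u, θ)` with `0 < a`, `0 < θ`, along the cell sequence `rs`:
`∃ σ₀ ∀ σ < σ₀ ∀ Φ ∀ τ ∀ g ∀ δ ∃ N₀ ∀ N ≥ N₀ ∀ h`, `‖S_h‖_{L¹(localGibbsLaw σ a u θ)} ≤ δ` at mesh `rs N` — i.e.
`MesoBody rs` with the three profile functions frozen to constants. Under constant profiles the local Gibbs law
is an INVARIANT canonical law of the flow, so this is the statement "kicks are `L¹`-fair under the invariant law
relative to their own equilibrium conditional mean `κ = E_G[g | σ(P)]`, uniformly over admissible weights of the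
mesoscopic past" (`κ` is computed under `localGibbsLaw σ 1 0 1`; for `(a, u, θ) ≠ (1, 0, 1)` the two invariant laws
differ by a density that is a function of total momentum and kinetic energy, both read off the past's first
photo, hence `σ(P)`-measurable: same `κ`, p99854 `condExp_withDensity_ae_eq_of_measurable`). -/
def EquilibriumMesoBody (rs : ℕ → ℝ) : Prop :=
  ∀ (a θ : ℝ) (u : V3), 0 < a → 0 < θ → ∃ σ₀ : ℝ, 0 < σ₀ ∧ ∀ σ : ℝ, 0 < σ → σ < σ₀ →
    ∀ Φ : (N : ℕ) → Flow σ N, ∀ τ : ℝ, 0 < τ →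
    ∀ g : V3 × V3 × V3 → ℝ, Continuous g → (∃ C : ℝ, ∀ p, |g p| ≤ C) →
    ∀ δ : ℝ, 0 < δ → ∃ N₀ : ℕ, ∀ N : ℕ, N₀ ≤ N →
    ∀ h : Fin (N + 1) → ℕ → PastRel N → ℝ, (∀ i n, Measurable (h i n)) →
    (∀ i n p, |h i n p| ≤ 1) →
      KickBoundRel σ (fun _ => a) (fun _ => θ) (fun _ => u) N (Φ N) τ (rs N) g h δ

/-- **`EquilibriumKickFairMeso` (the card's C⁺, `∀`-form)**: the equilibrium body along EVERY admissible cell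
sequence (`0 < rs N`, `rs N → 0`, `(N+1)(rs N)³ → ∞`). This is what the kinetic-window-triangle lever claims:
the equilibrium half holds at every admissible mesh (indeed the card expects it at every cell size; the triage
notes that the cheap leak bound `b = O(ε/rs) + O(φℓ/rs) → 0` uses the meso window, TRIAGE-r1-2/3). -/
def EquilibriumKickFairMeso : Prop :=
  ∀ rs : ℕ → ℝ, (∀ N, 0 < rs N) → Tendsto rs atTop (𝓝 0) → LowerEdge rs → EquilibriumMesoBody rs

/-- **`EquilibriumKickFairMesoSome` (`∃`-form)**: the equilibrium body along SOME admissible cell sequence —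
the form the crux literally implies (the crux is `∃ rs, admissible ∧ MesoBody rs`). -/
def EquilibriumKickFairMesoSome : Prop :=
  ∃ rs : ℕ → ℝ, (∀ N, 0 < rs N) ∧ Tendsto rs atTop (𝓝 0) ∧ LowerEdge rs ∧ EquilibriumMesoBody rs

/-! ## §2 Necessity certificates (why the residue is a support target and not a costume) -/

/-- **Constant profiles are profiles**: the crux's body along `rs` gives the equilibrium body along `rs`
(specialise `a₀, θ₀, u₀` to constant functions, which are continuous and positive). [folklore] -/
theorem equilibriumMesoBody_of_mesoBody {rs : ℕ → ℝ} (hB : MesoBody rs) : EquilibriumMesoBody rs := by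
  intro a θ u ha hθ
  exact hB (fun _ => a) (fun _ => θ) (fun _ => u) continuous_const continuous_const continuous_const
    (fun _ => ha) (fun _ => hθ)

/-- **The crux implies the equilibrium half (`∃`-form)** — so `EquilibriumKickFairMesoSome` is a NECESSARY
special case of `KickFairRelEquilibriumMeso`; it is strictly weaker (one profile triple per `(a, u, θ)` instead
of all continuous positive profiles), which is exactly why no skeleton `KickFairRelEquilibriumMeso_of` can be
built from it without a complement stub carrying the crux's whole non-equilibrium content. [folklore] -/
theorem equilibriumKickFairMesoSome_of_kickFairRelEquilibriumMeso (hK : KickFairRelEquilibriumMeso) :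
    EquilibriumKickFairMesoSome := by
  obtain ⟨rs, hpos, h0, h3, hB⟩ := kickFairRelEquilibriumMeso_iff.1 hK
  exact ⟨rs, hpos, h0, h3, equilibriumMesoBody_of_mesoBody hB⟩

/-- The default admissible witness `rs N = (N+1)^{-1/4}`: positive, `→ 0`, `(N+1)·rs³ = (N+1)^{1/4} → ∞`
(re-proved here from the disprover's `Disproof.lean §7 quarter_admissible`, which is a crux workfile and not
an importable module). [folklore] -/
theorem quarter_admissible :
    (∀ N : ℕ, 0 < ((N : ℝ) + 1) ^ (-(1 / 4 : ℝ))) ∧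
      Tendsto (fun N : ℕ => ((N : ℝ) + 1) ^ (-(1 / 4 : ℝ))) atTop (𝓝 0) ∧
      LowerEdge fun N : ℕ => ((N : ℝ) + 1) ^ (-(1 / 4 : ℝ)) := by
  have hN1 : Tendsto (fun N : ℕ => (N : ℝ) + 1) atTop atTop :=
    tendsto_atTop_add_const_right _ 1 tendsto_natCast_atTop_atTop
  refine ⟨fun N => by positivity, (tendsto_rpow_neg_atTop (by norm_num : (0 : ℝ) < 1 / 4)).comp hN1, ?_⟩
  have key : ∀ N : ℕ, ((N : ℝ) + 1) * (((N : ℝ) + 1) ^ (-(1 / 4 : ℝ))) ^ 3 =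
      ((N : ℝ) + 1) ^ (1 / 4 : ℝ) := by
    intro N
    have hN : (0 : ℝ) < (N : ℝ) + 1 := by positivity
    rw [← Real.rpow_natCast, ← Real.rpow_mul hN.le]
    conv_lhs => rw [show ((N : ℝ) + 1) = ((N : ℝ) + 1) ^ (1 : ℝ) by rw [Real.rpow_one]]
    rw [← Real.rpow_mul hN.le, ← Real.rpow_add hN]
    norm_num
  unfold LowerEdge
  simp_rw [key]
  exact (tendsto_rpow_atTop (by norm_num : (0 : ℝ) < 1 / 4)).comp hN1

/-- **`∀`-form ⇒ `∃`-form** (instantiate at the admissible witness `(N+1)^{-1/4}`). [folklore] -/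
theorem equilibriumKickFairMesoSome_of_equilibriumKickFairMeso (hA : EquilibriumKickFairMeso) :
    EquilibriumKickFairMesoSome := by
  obtain ⟨hpos, h0, h3⟩ := quarter_admissible
  exact ⟨_, hpos, h0, h3, hA _ hpos h0 h3⟩

/-! ## §3 The self-contained signature to file (certified definitionally equal to `EquilibriumKickFairMeso`)

`EquilibriumKickFairMesoSig` is the text of `signature-EquilibriumKickFairMeso.txt` (this seat's folder /
the `.md`): the crux's own signature with the prefix `∃ rs, adm ∧ ∀ profiles …` replaced by
`∀ rs, adm → ∀ (a θ : ℝ) (u : V3), 0 < a → 0 < θ → …` and `localGibbsLaw σ a₀ u₀ θ₀` by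
`localGibbsLaw σ (fun _ => a) (fun _ => u) (fun _ => θ)`, all constants fully qualified exactly as in the route
file, so that `ledger workitem add … --signature` can take it verbatim. The `example` below certifies (by
`Iff.rfl`) that it is the statement `EquilibriumKickFairMeso` of §1. -/

/-- The fileable, self-contained form of `EquilibriumKickFairMeso` (route-file vocabulary only). -/
def EquilibriumKickFairMesoSig : Prop :=
  ∀ rs : ℕ → ℝ, (∀ N, 0 < rs N) → Filter.Tendsto rs Filter.atTop (nhds 0) → Filter.Tendsto (fun N : ℕ => ((N : ℝ) + 1) * rs N ^ 3) Filter.atTop Filter.atTop → ∀ (a θ : ℝ) (u : Literature.MathematicalPhysics.KineticTheory.V3), 0 < a → 0 < θ → ∃ σ₀ : ℝ, 0 < σ₀ ∧ ∀ σ : ℝ, 0 < σ → σ < σ₀ → ∀ Φ : (N : ℕ) → Literature.Analysis.FluidPDE.HardSphereFlow (Literature.Analysis.FluidPDE.Torus.geometry (Fin 3)) (Literature.MathematicalPhysics.KineticTheory.hsDiameter σ N) (N + 1), ∀ τ : ℝ, 0 < τ → ∀ g : Literature.MathematicalPhysics.KineticTheory.V3 × Literature.MathematicalPhysics.KineticTheory.V3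 × Literature.MathematicalPhysics.KineticTheory.V3 → ℝ, Continuous g → (∃ C : ℝ, ∀ p, |g p| ≤ C) → ∀ δ : ℝ, 0 < δ → ∃ N₀ : ℕ, ∀ N : ℕ, N₀ ≤ N → ∀ h : Fin (N + 1) → ℕ → (((Fin (N + 1) → (Fin 3 → ℤ) × Literature.MathematicalPhysics.KineticTheory.V3) × (Fin (N + 1) → (Fin 3 → ℤ) × Literature.MathematicalPhysics.KineticTheory.V3)) × Fin (N + 1)) × (ℝ × ℝ × ℝ) → ℝ, (∀ i n, Measurable (h i n)) → (∀ i n p, |h i n p| ≤ 1) → let ε := Literature.MathematicalPhysics.KineticTheory.hsDiameter σ N; let G : Literature.Analysis.FluidPDE.Geometry (Fin 3) Literature.MathematicalPhysics.KineticTheory.T3 := Literature.Analysis.FluidPDE.Torus.geometry (Fin 3); let q : Literature.MathematicalPhysics.KineticTheory.T3 → (Fin 3 → ℤ) := Literature.Analysis.FluidPDE.Torus.coarseCell (rs N); let γ : Literature.Analysis.FluidPDE.Config (N + 1) (Fin 3) Literature.MathematicalPhysics.KineticTheory.T3 → ℝ → Literature.Analysis.FluidPDE.Config (N + 1) (Fin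 3) Literature.MathematicalPhysics.KineticTheory.T3 := fun z s => (Φ N).flow s z; let cnt : Literature.Analysis.FluidPDE.Config (N + 1) (Fin 3) Literature.MathematicalPhysics.KineticTheory.T3 → Fin (N + 1) → ℕ := fun z i => Set.ncard (Literature.Analysis.FluidPDE.collisionTimesOf G ε (γ z) i ∩ Set.Ioc 0 τ); let P : Literature.Analysis.FluidPDE.Config (N + 1) (Fin 3) Literature.MathematicalPhysics.KineticTheory.T3 → Fin (N + 1) → ℕ → (((Fin (N + 1) → (Fin 3 → ℤ) × Literature.MathematicalPhysics.KineticTheory.V3) × (Fin (N + 1) → (Fin 3 → ℤ) × Literature.MathematicalPhysics.KineticTheory.V3)) × Fin (N + 1)) × (ℝ × ℝ × ℝ) := fun z i n => if z ∈ (Φ N).good then (((Φ N).coarsePastOf q i n z, (Φ N).nthPartnerOf i n z), (Literature.Analysis.FluidPDE.flightStart G ε (γ z) 0 i ((Φ N).nthCollisionTimeOf i n z), Literature.Analysis.FluidPDE.flightStart G ε (γ z) 0 ((Φ N).nthPartnerOf i n z) ((Φ N).nthCollisionTimeOf i n z), (Φ N).nthCollisionTimeOf i n z)) else (((fun _ =>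 (0, 0), fun _ => (0, 0)), 0), (0, 0, 0)); let X : Fin (N + 1) → ℕ → Literature.Analysis.FluidPDE.Config (N + 1) (Fin 3) Literature.MathematicalPhysics.KineticTheory.T3 → Literature.MathematicalPhysics.KineticTheory.V3 × Literature.MathematicalPhysics.KineticTheory.V3 × Literature.MathematicalPhysics.KineticTheory.V3 := fun i n z => if z ∈ (Φ N).good then (((Φ N).nthRecordOf i n z).impactVec, ((Φ N).nthRecordOf i n z).preVel) else 0; let κ : Fin (N + 1) → ℕ → Literature.Analysis.FluidPDE.Config (N + 1) (Fin 3) Literature.MathematicalPhysics.KineticTheory.T3 → ℝ := fun i n => MeasureTheory.condExp (MeasurableSpace.comap (fun z => P z i n) inferInstance) (Literature.MathematicalPhysics.KineticTheory.localGibbsLaw σ (fun _ => 1) (fun _ => 0) (fun _ => 1) N (Φ N)) (fun z => g (X i n z)); let S : Literature.Analysis.FluidPDE.Config (N + 1) (Fin 3) Literature.MathematicalPhysics.KineticTheory.T3 → ℝ := fun z => ε / (N + 1 : ℝ) * ∑ i : Fin (N + 1), ∑ n ∈ Finset.range (cnt z i), h i n (P z i n) * (g (X i n z) - κ i n z); ∫⁻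 z, ENNReal.ofReal |S z| ∂(Literature.MathematicalPhysics.KineticTheory.localGibbsLaw σ (fun _ => a) (fun _ => u) (fun _ => θ) N (Φ N)) ≤ ENNReal.ofReal δ

/-- `EquilibriumKickFairMesoSig` IS `EquilibriumKickFairMeso` (definitional unfolding of the landed
`kickSumRel` / `KickBoundRel` let-chain). [folklore] -/
theorem equilibriumKickFairMesoSig_iff : EquilibriumKickFairMesoSig ↔ EquilibriumKickFairMeso :=
  Iff.rfl

end

end Summit.AtomisticToContinuum.HydrodynamicLimit.Cruxes.KickFairRelEquilibriumMeso.KineticWindowTriangle
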